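import Literature.Probability.Percolation.SeededExplorer
import HarnessLib

/-!
# The frontier of the seeded exploration: beaches, the type dichotomy and the docking lemma

Topic `Literature/Probability/Percolation`; definitions-and-proofs support file (no named fact)
for the mesh-independent gluing Proposition 4.1 of O. Schramm, S. Smirnov, *On the scaling limits
of planar percolation*, Ann. Probab. 39 (2011), arXiv:1101.5820, §4 ("Bays and beaches", p. 18):

> "Each connected component of `K ∖ Γ` which meets `β'` will be called a bay. … The union of the
> tiles of `H_η` that intersect `B` as well as `∂B ∖ β'` will be called the beach of `B`.  It is
> easy to see that the beach is connected, and all the tiles in the beach are either open (i.e.,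
> in `ω̃`) or closed (not in `ω̃`)."

For bond percolation on `ℤ²` and the seeded boundary-interface exploration of
`SeededExplorer.lean` (explored clusters `𝒪`, `𝒟`, terminal data `Seeded.IsTerminal`), the
unexplored pockets are the regions of faces not in `𝒟`, and their boundary towards the explored
world is the **frontier**: the lattice edges separating a face of `𝒟` from a face not in `𝒟`
(`Seeded.IsFrontier`).  This file proves the local structure of the frontier at termination —
the lattice form of "all the tiles in the beach are either open or closed":

* `IsTerminal.frontier_dichotomy` — **type dichotomy**: an EXAMINABLE frontier edge is either
  examined, open, with both endpoints in `𝒪` (type α: a **beach edge**, `Seeded.IsBeachEdge`) or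
  unexamined with no endpoint in `𝒪` (type β) (the box case is
  `BoundaryExplorerInterface.IsTerminal.type_dichotomy`); hence two examinable frontier edges of
  different types never share a vertex (`IsTerminal.isBeachEdge_of_isFrontier_of_mem`: along the
  frontier the type can change only across non-examinable edges — the mouths of the bays on the
  fresh side and the excised squares);
* `IsTerminal.exists_isFrontier_of_oReach` — **docking lemma**: if a site `v ∈ 𝒪` off the seeds
  corners a face not in `𝒟` (e.g. a face of a fresh edge at `v`, `IsTerminal.not_dReach_of_not_mem`),
  then some lattice edge at `v` is a frontier edge, and every examinable frontier edge at `v` is a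
  beach edge (`IsTerminal.isBeachEdge_of_isFrontier_of_oReach`): fresh open paths dock onto the explored world
  only at beach vertices.

## References

* O. Schramm, S. Smirnov, Ann. Probab. 39 (2011) 1768–1814, arXiv:1101.5820, §4, proof of
  Prop. 4.1 ("Bays and beaches"). [SchrammSmirnov2011]
* J. van den Berg, P. Nolin, Progr. Probab. 77 (2020) = arXiv:2008.01606, §5.2.
  [VandenbergNolin2020]

Tree: `Seeded.IsTerminal` and its consequences (`SeededExplorer.lean`); `SeparatesFaces`,
`TouchesFace`, `IsFaceOf`, `exists_edge_of_touchesFace`, `touchesFace_of_isFaceOf`,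
`isFaceOf_left/right_of_dualEdge_eq` (`LatticeFaceParity.lean`).
-/

noncomputable section

namespace Literature.Probability.Percolation

open LatticeModels Relation

namespace Seeded

variable (𝔖 : Seeds)

/-! ### The frontier and the beach edges -/

/-- **Frontier edges**: lattice edges separating a face of `𝒟` from a face not in `𝒟` — the
boundary of the unexplored pockets towards the explored world.
[cite: SchrammSmirnov2011, §4, proof of Prop. 4.1 (∂B ∖ β')] -/
def IsFrontier (X : Finset (Sym2 (Site 2))) (ω : BondConfig (Site 2)) (e : Sym2 (Site 2)) : Prop :=
  SeparatesFaces {f | DReach 𝔖 X ω f} e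

/-- **Beach edges**: examined open frontier edges ("the tiles in the beach are … open").
[cite: SchrammSmirnov2011, §4, proof of Prop. 4.1 (the beach of a bay)] -/
def IsBeachEdge (X : Finset (Sym2 (Site 2))) (ω : BondConfig (Site 2)) (e : Sym2 (Site 2)) : Prop :=
  e ∈ X ∧ e ∈ ω ∧ IsFrontier 𝔖 X ω e

variable {𝔖}

/-- Unfolding of `IsFrontier`. [folklore] -/
theorem isFrontier_iff {X : Finset (Sym2 (Site 2))} {ω : BondConfig (Site 2)} {e : Sym2 (Site 2)} :
    IsFrontier 𝔖 X ω e ↔ ∃ a b : Site 2, dualEdge e = s(a, b) ∧ DReach 𝔖 X ω a ∧ ¬ DReach 𝔖 X ω b :=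
  Iff.rfl

section Terminal

variable {X : Finset (Sym2 (Site 2))} {ω : BondConfig (Site 2)} (hT : IsTerminal 𝔖 X ω)
include hT

/-- **Type dichotomy of examinable frontier edges**: examined, open, with both endpoints in `𝒪`
(type α, a beach edge), or unexamined with no endpoint in `𝒪` (type β).  (Examined closed edges
have both faces in `𝒟`, so they are never frontier edges; an unexamined examinable edge with a
face in `𝒟` and an endpoint in `𝒪` would be eligible.)
[cite: SchrammSmirnov2011, §4, proof of Prop. 4.1 ("all the tiles in the beach are either open or closed")] -/
theorem IsTerminal.frontier_dichotomy {e : Sym2 (Site 2)} (he : e ∈ 𝔖.A) (hfr : IsFrontier 𝔖 X ω e) :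
    (e ∈ X ∧ e ∈ ω ∧ ∀ v ∈ e, OReach 𝔖 X ω v) ∨ (e ∉ X ∧ ∀ v ∈ e, ¬ OReach 𝔖 X ω v) := by
  obtain ⟨a, b, hd, ha, hb⟩ := hfr
  by_cases heX : e ∈ X
  · left
    have heω : e ∈ ω := by
      by_contra heω
      exact hb (hT.dReach_of_mem heX heω (isFaceOf_right_of_dualEdge_eq hd))
    exact ⟨heX, heω, fun v hv => hT.oReach_of_mem heX heω hv⟩
  · right
    exact ⟨heX, fun v hv hO => hT.not_dReach_of_not_mem he heX hv hO (isFaceOf_left_of_dualEdge_eq hd) ha⟩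

/-- An examinable frontier edge with an endpoint in `𝒪` is a beach edge. [cite: SchrammSmirnov2011, §4, proof of Prop. 4.1 (the beach)] -/
theorem IsTerminal.isBeachEdge_of_isFrontier_of_oReach {e : Sym2 (Site 2)} (he : e ∈ 𝔖.A)
    (hfr : IsFrontier 𝔖 X ω e) {v : Site 2} (hv : v ∈ e) (hO : OReach 𝔖 X ω v) :
    IsBeachEdge 𝔖 X ω e := by
  rcases hT.frontier_dichotomy he hfr with h | h
  · exact ⟨h.1, h.2.1, hfr⟩
  · exact absurd hO (h.2 v hv)

/-- Beach edges have both endpoints in `𝒪`. [folklore] -/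
theorem IsTerminal.oReach_of_isBeachEdge {e : Sym2 (Site 2)} (hb : IsBeachEdge 𝔖 X ω e) {v : Site 2}
    (hv : v ∈ e) : OReach 𝔖 X ω v :=
  hT.oReach_of_mem hb.1 hb.2.1 hv

/-- **Types do not mix at a vertex**: an examinable frontier edge sharing a vertex with a beach
edge is a beach edge (along the frontier, the type can change only across non-examinable edges).
[cite: SchrammSmirnov2011, §4, proof of Prop. 4.1 ("the beach is connected, and all the tiles in the beach are either open or closed")] -/
theorem IsTerminal.isBeachEdge_of_isFrontier_of_mem {e g : Sym2 (Site 2)} (hb : IsBeachEdge 𝔖 X ω e)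
    (hg : g ∈ 𝔖.A) (hfr : IsFrontier 𝔖 X ω g) {v : Site 2} (hve : v ∈ e) (hvg : v ∈ g) :
    IsBeachEdge 𝔖 X ω g :=
  hT.isBeachEdge_of_isFrontier_of_oReach hg hfr hvg (hT.oReach_of_isBeachEdge hb hve)

/-- An examined frontier edge is a beach edge (examined closed edges have both faces in `𝒟`).
[folklore] -/
theorem IsTerminal.isBeachEdge_of_isFrontier_of_mem_examined {e : Sym2 (Site 2)} (heX : e ∈ X)
    (hfr : IsFrontier 𝔖 X ω e) : IsBeachEdge 𝔖 X ω e := by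
  rcases hT.frontier_dichotomy (hT.subset heX) hfr with h | h
  · exact ⟨h.1, h.2.1, hfr⟩
  · exact absurd heX h.1

/-! ### The docking lemma -/

/-- **Docking lemma, frontier form.**  If a site `v ∈ 𝒪` off the seeds corners a face not in
`𝒟`, then some lattice edge at `v` is a frontier edge: `v` is the endpoint of an examined open
edge, which has a face in `𝒟` cornered at `v`, and among the four faces around `v` the property
"in `𝒟`" changes across some edge at `v`.
[cite: SchrammSmirnov2011, §4, proof of Prop. 4.1 ("each point in β' is in the closure of some bay")] -/
theorem IsTerminal.exists_isFrontier_of_oReach {v : Site 2} (hO : OReach 𝔖 X ω v) (hv : v ∉ 𝔖.O₀)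
    {f' : Site 2} (hf' : TouchesFace v f') (hD' : ¬ DReach 𝔖 X ω f') :
    ∃ g ∈ (zdGraph 2).edgeSet, v ∈ g ∧ IsFrontier 𝔖 X ω g := by
  rcases exists_mem_of_oReach hO with h | ⟨e, heX, heω, hve⟩
  · exact absurd h hv
  · obtain ⟨f, hf, hD⟩ := hT.exists_isFaceOf_dReach heX
    have he := 𝔖.A_subset e (hT.subset heX)
    obtain ⟨g, hg, hvg, a, b, hd, hPa, hPb⟩ :=
      exists_edge_of_touchesFace (P := fun f => DReach 𝔖 X ω f) (touchesFace_of_isFaceOf he hf hve) hf' hD hD'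
    exact ⟨g, hg, hvg, a, b, hd, hPa, hPb⟩

/-- **Docking lemma.**  A site `v ∈ 𝒪` off the seeds carrying a fresh (unexamined, examinable)
edge is an endpoint of a frontier edge; every examinable frontier edge at `v` is a beach edge
(`isBeachEdge_of_isFrontier_of_oReach`).  Fresh open paths dock onto the explored open clusters
only at beach vertices. [cite: SchrammSmirnov2011, §4, proof of Prop. 4.1 (bays, beaches and the graph G*)] -/
theorem IsTerminal.exists_isFrontier_of_fresh {v : Site 2} (hO : OReach 𝔖 X ω v) (hv : v ∉ 𝔖.O₀)
    {e : Sym2 (Site 2)} (he : e ∈ 𝔖.A) (heX : e ∉ X) (hve : v ∈ e) :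
    ∃ g ∈ (zdGraph 2).edgeSet, v ∈ g ∧ IsFrontier 𝔖 X ω g := by
  have heE := 𝔖.A_subset e he
  obtain ⟨a, b, -, hd⟩ := exists_dualEdge_eq_mk heE
  have hfa : IsFaceOf a e := isFaceOf_left_of_dualEdge_eq hd
  exact hT.exists_isFrontier_of_oReach hO hv (touchesFace_of_isFaceOf heE hfa hve)
    (hT.not_dReach_of_not_mem he heX hve hO hfa)

/-- **Docking lemma, beach form**: if moreover every lattice edge at `v` is examinable (a site of
the strip away from the mouths and the squares), then `v` is an endpoint of a beach edge.
[cite: SchrammSmirnov2011, §4, proof of Prop. 4.1 (bays, beaches and the graph G*)] -/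
theorem IsTerminal.exists_isBeachEdge_of_fresh {v : Site 2} (hO : OReach 𝔖 X ω v) (hv : v ∉ 𝔖.O₀)
    (hA : ∀ g ∈ (zdGraph 2).edgeSet, v ∈ g → g ∈ 𝔖.A)
    {e : Sym2 (Site 2)} (he : e ∈ 𝔖.A) (heX : e ∉ X) (hve : v ∈ e) :
    ∃ g, v ∈ g ∧ IsBeachEdge 𝔖 X ω g := by
  obtain ⟨g, hg, hvg, hfr⟩ := hT.exists_isFrontier_of_fresh hO hv he heX hve
  exact ⟨g, hvg, hT.isBeachEdge_of_isFrontier_of_oReach (hA g hg hvg) hfr hvg hO⟩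

/-! ### Where `𝒟` and `𝒪` live -/

omit hT in
/-- Faces of `𝒟` off the seeds are faces of examined closed edges. [folklore] -/
theorem exists_mem_of_dReach {f : Site 2} (hf : DReach 𝔖 X ω f) :
    f ∈ 𝔖.D₀ ∨ ∃ e ∈ X, e ∉ ω ∧ IsFaceOf f e := by
  obtain ⟨g, hg, h⟩ := hf
  induction h with
  | refl => exact Or.inl hg
  | @tail a b _ hab _ =>
    obtain ⟨e, heX, heω, -, hd⟩ := hab
    exact Or.inr ⟨e, heX, heω, isFaceOf_right_of_dualEdge_eq hd⟩

/-- At a site of `𝒪`, an examinable edge is examined or has no face in `𝒟` (bookkeeping form of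
termination). [folklore] -/
theorem IsTerminal.mem_or_forall_not_dReach {v : Site 2} (hO : OReach 𝔖 X ω v) {e : Sym2 (Site 2)}
    (he : e ∈ 𝔖.A) (hve : v ∈ e) :
    e ∈ X ∨ ∀ f, IsFaceOf f e → ¬ DReach 𝔖 X ω f := by
  by_cases heX : e ∈ X
  · exact Or.inl heX
  · exact Or.inr fun f hf => hT.not_dReach_of_not_mem he heX hve hO hf

end Terminal

end Seeded

end Literature.Probability.Percolation
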